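import Literature.NumberTheory.EllipticCurves.GreenbergVatsal2000.GreenbergSelmerGroups
import Literature.NumberTheory.EllipticCurves.IwasawaSelmerProofs
import Literature.NumberTheory.GaloisRepresentations.LocalGaloisGroupProofs
import HarnessLib

/-!
# Road T for item 23110, input H-FIN, part 1: the conjugation action of the decomposition group on the inertia classes
# `H¹(H ∩ I_v, M)` and its compatibility with the detecting map `r_v` (GV currency)

Route `ResidualThetaTransportAtTwo` (RTT, crux r201, stmt-BirchSwinnertonDyer-23110) / `ThetaPartnerAtTwo`; seat `prover-bsd-wall-tp2-p2x` g12 LEAD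
(`--supports stmt-BirchSwinnertonDyer-23110`). THEOREMS ONLY (no definition, no named fact, no `sorry`); closes nothing.

Greenberg–Vatsal (Invent. math. 142 (2000), §2 pp. 16–17, 20–22): the local factor `𝓗_v = ∏_{η ∣ v} H¹((ℚ_∞)_η, E[p^∞]) ↪ ∏ H¹(I_η, E[p^∞])`
carries the action of the decomposition group. In the tree's place-by-place formalism (`GreenbergSelmer.inertiaIn H v ≤ decomp v`,
detecting map `r_v = resH1Hom (inertiaInToH H v) id : H¹(H, M) → H¹(H ∩ I_v, M)`), the subgroup `inertiaIn H v` is NORMAL in the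
decomposition group `decomp v` (`H ⊴ Γ_K`, `I_v ⊴ D_v`), so `decomp v` acts on `H¹(H ∩ I_v, M)` by the tree's `conjH1`, and `r_v`
intertwines the two conjugations:

* `inertiaIn_normal` — `(inertiaIn H v).Normal` in `decomp v`;
* `resH1Hom_inertiaInToH_conjH1` — `r_v (conj_δ c) = conj_δ (r_v c)` for `δ ∈ D_v`;
* `conjH1_eq_pow_zsmul_of_conjH1_eq_zsmul` — `conj_γ c = u • c ⟹ conj_{γ^n} c = u^n • c`;
* `resH1Hom_inertiaInToH_eigen` — if `conj_γ c = u • c` and `γ^N = h · δ` with `h ∈ H`, `δ ∈ D_v`, then `r_v c` is an eigenvector of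
  `conj_δ` on `H¹(H ∩ I_v, M)` with eigenvalue `u^N` — the input of the eigen-finiteness count
  (`…RlfPrimaryTorsionEigenFinite.finite_setOf_infinite_eigenspace`) for the `u`-eigenclasses of `Sel♯_{S₀}` (hypothesis `hfinE` of
  `TwistedPT.hlevEventual_two_of_plusDualAlt_of_eigen`).

HONEST FRAMING: closes nothing; 23110 is NOT proved; BSD is not proved by any of this.
References: [GreenbergVatsal2000] §2 pp. 16–17, 20–22; [NeukirchSchmidtWingberg2008] I §5; [GreenbergLNM1716] §4 p. 113.
-/

-- the Theorems namespace of this sub repeats the summit name by design (D-0017 nested layout)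
set_option linter.dupNamespace false

noncomputable section

open scoped Classical

open NumberField IsDedekindDomain Field
open Literature.NumberTheory.EllipticCurves Literature.NumberTheory.GaloisRepresentations
  Literature.NumberTheory.EllipticCurves.GreenbergSelmer Literature.NumberTheory.EllipticCurves.GreenbergVatsal2000

universe u

namespace Summit.BirchSwinnertonDyer.BirchSwinnertonDyer.Theorems.SignedEC.SharpEigen

variable {K : Type u} [Field K] [NumberField K] (H : Subgroup (absoluteGaloisGroup K)) [H.Normal]
  (v : HeightOneSpectrum (𝓞 K)) (M : Type u) [AddCommGroup M] [DistribMulAction (absoluteGaloisGroup K) M]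
  [TopologicalSpace M] [DiscreteTopology M]

/-- **`H ∩ I_v` is normal in `D_v`**: `inertiaIn H v ⊴ decomp v` (`H ⊴ Γ_K`; `I_v = res(I_{K_v}) ⊴ res(Γ_{K_v}) = D_v` because
`I_{K_v} ⊴ Γ_{K_v}`, `absInertia_normal_holds`). [cite: NeukirchSchmidtWingberg2008, (7.5.2)] -/
theorem inertiaIn_normal : (inertiaIn H v).Normal := by
  refine ⟨fun x hx δ ↦ ?_⟩
  rw [mem_inertiaIn_iff] at hx ⊢
  refine ⟨?_, ?_⟩
  · have h := ‹H.Normal›.conj_mem _ hx.1 (δ : absoluteGaloisGroup K)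
    simpa using h
  · -- `I_v ⊴ D_v`
    obtain ⟨σ, hσ⟩ := (mem_decomp_iff v (δ : absoluteGaloisGroup K)).1 δ.2
    obtain ⟨ι, hι, hιx⟩ := Subgroup.mem_map.1 hx.2
    haveI : (absInertia (v.adicCompletion K)).Normal :=
      Literature.NumberTheory.GaloisRepresentations.absInertia_normal_holds (v.adicCompletion K)
    refine Subgroup.mem_map.2 ⟨σ * ι * σ⁻¹, ‹(absInertia (v.adicCompletion K)).Normal›.conj_mem ι hι σ, ?_⟩
    change absGaloisRestrict K (v.adicCompletion K) (σ * ι * σ⁻¹) = ((δ * x * δ⁻¹ : decomp (K := K) v) : absoluteGaloisGroup K)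
    rw [map_mul, map_mul, map_inv, hσ, Subgroup.coe_mul, Subgroup.coe_mul, Subgroup.coe_inv]
    rw [← hιx]
    rfl

/-- **`r_v ∘ conj_δ = conj_δ ∘ r_v`** for `δ ∈ D_v`: the detecting map `r_v : H¹(H, M) → H¹(H ∩ I_v, M)` intertwines the conjugation by
`δ` on `H¹(H, M)` (`conjH1 H M δ`) with the conjugation by `δ` on `H¹(H ∩ I_v, M)` (both composites are induced by the same compatible pair).
[cite: NeukirchSchmidtWingberg2008, I §5] -/
theorem resH1Hom_inertiaInToH_conjH1 (δ : decomp (K := K) v) (c : subgroupH1 H M) :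
    haveI := inertiaIn_normal H v
    resH1Hom (inertiaInToH H v) (AddMonoidHom.id M) (fun _ _ ↦ rfl) (conjH1 H M (δ : absoluteGaloisGroup K) c) =
      conjH1 (inertiaIn H v) M δ (resH1Hom (inertiaInToH H v) (AddMonoidHom.id M) (fun _ _ ↦ rfl) c) := by
  haveI := inertiaIn_normal H v
  change ((resH1Hom (inertiaInToH H v) (AddMonoidHom.id M) (fun _ _ ↦ rfl)).comp
      (conjH1 H M (δ : absoluteGaloisGroup K))) c =
    ((conjH1 (inertiaIn H v) M δ).comp (resH1Hom (inertiaInToH H v) (AddMonoidHom.id M) (fun _ _ ↦ rfl))) c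
  congr 1
  rw [conjH1, conjH1, resH1Hom_comp, resH1Hom_comp]
  exact resH1Hom_congr (ContinuousMonoidHom.ext fun x ↦ Subtype.ext (by
      simp only [ContinuousMonoidHom.comp_toFun, subgroupConj_apply_coe]
      rfl))
    (AddMonoidHom.ext fun _ ↦ rfl) _ _

omit [NumberField K] in
/-- `conj_γ c = u • c ⟹ conj_{γⁿ} c = uⁿ • c`. [cite: GreenbergLNM1716, §4 p. 124] -/
theorem conjH1_pow_eq_zsmul_of_conjH1_eq_zsmul {γ : absoluteGaloisGroup K} {u : ℤ} {c : subgroupH1 H M}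
    (hc : conjH1 H M γ c = u • c) (n : ℕ) : conjH1 H M (γ ^ n) c = u ^ n • c := by
  induction n with
  | zero => rw [pow_zero, pow_zero, one_smul, conjH1_one_holds H M]; rfl
  | succ n ih => rw [pow_succ, conjH1_mul_holds H M, AddMonoidHom.comp_apply, hc, map_zsmul, ih, smul_smul, pow_succ, mul_comm]

/-- **The local image of a `u`-eigenclass is a `u^N`-eigenvector of the local conjugation.** If `conj_γ c = u • c` and `γ^N = h · δ` with
`h ∈ H`, `δ ∈ D_v`, then `conj_δ (r_v c) = u^N • r_v c` on `H¹(H ∩ I_v, M)` (`conj_h` is the identity on `H¹(H, M)`, inner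
automorphism: `conjH1_of_mem_holds`). [cite: GreenbergVatsal2000, §2 p. 20] [cite: GreenbergLNM1716, §4 p. 124] -/
theorem resH1Hom_inertiaInToH_eigen {γ : absoluteGaloisGroup K} {u : ℤ} {c : subgroupH1 H M}
    (hc : conjH1 H M γ c = u • c) {N : ℕ} (δ : decomp (K := K) v) {h : absoluteGaloisGroup K} (hh : h ∈ H)
    (hγ : γ ^ N = h * (δ : absoluteGaloisGroup K)) :
    haveI := inertiaIn_normal H v
    conjH1 (inertiaIn H v) M δ (resH1Hom (inertiaInToH H v) (AddMonoidHom.id M) (fun _ _ ↦ rfl) c) =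
      u ^ N • resH1Hom (inertiaInToH H v) (AddMonoidHom.id M) (fun _ _ ↦ rfl) c := by
  haveI := inertiaIn_normal H v
  have h1 : conjH1 H M (δ : absoluteGaloisGroup K) c = u ^ N • c := by
    have h2 := conjH1_pow_eq_zsmul_of_conjH1_eq_zsmul H M hc N
    rw [hγ, conjH1_mul_holds H M, AddMonoidHom.comp_apply, conjH1_of_mem_holds H M hh, AddMonoidHom.id_apply] at h2
    exact h2
  rw [← resH1Hom_inertiaInToH_conjH1, h1, map_zsmul]

end Summit.BirchSwinnertonDyer.BirchSwinnertonDyer.Theorems.SignedEC.SharpEigen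

end
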